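import Summits.CriticalPhenomena.PercolationContinuityZ3.Theorems.PercNearOneGluingNoHeavyLowerTailWorstPairExchangeIdentity
import Summits.CriticalPhenomena.PercolationContinuityZ3.Theorems.PercNearOneGluingNearOneGluingWeightContinuity
import Literature.Probability.LatticeModels.ProdBernoulliIndependence
import HarnessLib

/-! # Crux `PercNearOneGluing.NoHeavyLowerTail` (stmt-CriticalPhenomena-4575) — DEGENERATE CLOSURE of event gluing:
# `EG_k` with the sharp constant `1` at the WORST relay, for all weight vectors with every weight `< 1`, already implies the crux

Support file (new-inequality factory seat `prim-ineq-gen-7`; `--supports stmt-CriticalPhenomena-4575`); no definitions, no named facts,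
no sorries.

Every law-level certificate for the k-relay event gluing `EG_k : μ({o↔A} ∩ {o↮c}) ≤ μ{r↮c}` (`r` the worst relay) — the refined
Kozma–Nitzan residual `(KNS')_k` of `Theorems.EGkResidual.eventGluing_of_refinedResidual` (this seat), the `k = 3` certificate rows of
`Theorems.EG3Residual.eg3_of_refinedResidual` (prove-4), LP certificates checked by `CertCheck` — divides by conditioning masses and is
therefore stated only on NONDEGENERATE instances.  THIS FILE removes that restriction once and for all, by the scaled-weights limit of
`Theorems.lonelyRelay_of_terminalSeparation`: with all weights `< 1` every separation event of disjoint vertex sets contains the empty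
configuration and is non-null (`sep_real_pos`), and event gluing for the scaled weights `(1 − 1/(k+1)) • w` passes to the limit `w` by the
weight continuity `stub_weightContinuity`; `Theorems.noHeavyLowerTail_of_eventGluingConst 1` then gives the crux.  Results:

* `sep_real_pos` — all weights `< 1`, `S ∩ T = ∅` ⟹ `0 < μ{S ↮ T}`;
* `noHeavyLowerTail_of_eventGluingLtOne` — **if `EG_k` (constant 1) holds at a worst relay on every finite weighted graph whose weights are
  all `< 1`, then `NoHeavyLowerTail`.**  (So certificate provers may assume `∀ e, w e < 1`, hence every `μ{S ↮ T} > 0`.)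
[cite: KozmaNitzan2024, Conjecture 3 (p. 15), Theorem 2 (§3.1, pp. 8–9)]
-/

namespace Summit.CriticalPhenomena.PercolationContinuityZ3.Theorems

open MeasureTheory Set Filter Topology Literature.Probability.LatticeModels Literature.Probability.Percolation

noncomputable section
open Classical

variable {n : ℕ}

namespace EventGluingClosure

/-- With all weights `< 1`, a separation event between DISJOINT vertex sets is non-null (it contains the empty configuration).
[folklore; product measure] -/
theorem sep_real_pos (w : Sym2 (Fin n) → unitInterval) (hw : ∀ e, (w e : ℝ) < 1) (S T : Finset (Fin n))
    (hST : Disjoint S T) :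
    0 < (prodBernoulli w).real {ω : BondConfig (Fin n) | ∀ s ∈ S, ∀ x ∈ T, ¬ (openGraph ω).Reachable s x} := by
  have hsub : {ω : Set (Sym2 (Fin n)) | ∀ e ∈ (Finset.univ : Finset (Sym2 (Fin n))), e ∉ ω} ⊆
      {ω : BondConfig (Fin n) | ∀ s ∈ S, ∀ x ∈ T, ¬ (openGraph ω).Reachable s x} := by
    intro ω hω s hs x hx hconn
    have hempty : ω = ∅ := Set.eq_empty_iff_forall_notMem.2 fun e he => hω e (Finset.mem_univ e) he
    have hbot : openGraph ω = ⊥ := by rw [hempty]; exact SimpleGraph.fromEdgeSet_empty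
    rw [hbot, SimpleGraph.reachable_bot] at hconn
    subst hconn
    exact Finset.disjoint_left.1 hST hs hx
  refine lt_of_lt_of_le ?_ (measureReal_mono hsub)
  rw [prodBernoulli_real_forall_notMem]
  exact Finset.prod_pos fun e _ => sub_pos.2 (hw e)

/-- **Degenerate closure of event gluing.** If on every finite weighted graph WITH ALL WEIGHTS `< 1`, for every relay set `A`,
observer `o ∉ A`, sink `c` and WORST relay `r ∈ A` (`μ{a ↮ c} ≤ μ{r ↮ c}` for all `a ∈ A`) the event gluing
`μ({o ↔ A} ∩ {o ↮ c}) ≤ μ{r ↮ c}` holds, then `NoHeavyLowerTail`.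
[cite: KozmaNitzan2024, Conjecture 3 (p. 15), Theorem 2 (§3.1, pp. 8–9)] -/
theorem noHeavyLowerTail_of_eventGluingLtOne
    (hEG1 : ∀ (n : ℕ) (w : Sym2 (Fin n) → unitInterval) (A : Finset (Fin n)) (o c r : Fin n), r ∈ A → o ∉ A →
      (∀ e, (w e : ℝ) < 1) →
      (∀ a ∈ A, (prodBernoulli w).real ((openConn a c : Set (BondConfig (Fin n)))ᶜ) ≤
        (prodBernoulli w).real ((openConn r c : Set (BondConfig (Fin n)))ᶜ)) →
      (prodBernoulli w).real ((⋃ a ∈ A, (openConn o a : Set (BondConfig (Fin n)))) ∩ (openConn o c)ᶜ) ≤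
        (prodBernoulli w).real ((openConn r c : Set (BondConfig (Fin n)))ᶜ)) :
    Summit.CriticalPhenomena.PercolationContinuityZ3.Theses.PercNearOneGluing.NoHeavyLowerTail := by
  refine noHeavyLowerTail_of_eventGluingConst 1 zero_le_one ?_
  intro n w A o c s hs hcut
  rw [one_mul]
  by_cases hA : A = ∅
  · subst hA
    simp
    exact hs
  by_cases hoA : o ∈ A
  · exact (measureReal_mono Set.inter_subset_left).trans (hcut o hoA)
  have hAne : A.Nonempty := Finset.nonempty_iff_ne_empty.2 hA
  -- event gluing with constant 1 whenever all weights are `< 1`, at the worst relay, bounded by the `sup'`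
  have hEG : ∀ w' : Sym2 (Fin n) → unitInterval, (∀ e, (w' e : ℝ) < 1) →
      (prodBernoulli w').real ((openConn o c : Set (BondConfig (Fin n)))ᶜ ∩ ⋃ a ∈ A, openConn o a) ≤
        A.sup' hAne (fun a => (prodBernoulli w').real ((openConn a c : Set (BondConfig (Fin n)))ᶜ)) := by
    intro w' hw'
    obtain ⟨r, hrA, hrmax⟩ := Finset.exists_max_image A
      (fun a => (prodBernoulli w').real ((openConn a c : Set (BondConfig (Fin n)))ᶜ)) hAne
    have hEGr := hEG1 n w' A o c r hrA hoA hw' hrmax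
    rw [Set.inter_comm] at hEGr
    exact hEGr.trans (Finset.le_sup' (fun a => (prodBernoulli w').real ((openConn a c : Set (BondConfig (Fin n)))ᶜ)) hrA)
  -- scaled weights `w_k = (1 - 1/(k+1)) • w` (all `< 1`) converging to `w`, as in `lonelyRelay_of_terminalSeparation`
  have hcmem : ∀ k : ℕ, ((1 : ℝ) - 1 / ((k : ℝ) + 1)) ∈ unitInterval := by
    intro k
    have hk : (0 : ℝ) < (k : ℝ) + 1 := Nat.cast_add_one_pos k
    have h1 : 1 / ((k : ℝ) + 1) ≤ 1 := by rw [div_le_one hk]; linarith [(Nat.cast_nonneg k : (0 : ℝ) ≤ k)]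
    have h0 : 0 ≤ 1 / ((k : ℝ) + 1) := by positivity
    exact ⟨by linarith, by linarith⟩
  set wk : ℕ → Sym2 (Fin n) → unitInterval :=
    fun k e => ⟨(1 - 1 / ((k : ℝ) + 1)) * (w e : ℝ), unitInterval.mul_mem (hcmem k) (w e).2⟩ with hwk_def
  have hwk_lt : ∀ k e, ((wk k e : unitInterval) : ℝ) < 1 := by
    intro k e
    have hc : (1 : ℝ) - 1 / ((k : ℝ) + 1) < 1 := by
      have : 0 < 1 / ((k : ℝ) + 1) := by positivity
      linarith
    calc ((wk k e : unitInterval) : ℝ) = (1 - 1 / ((k : ℝ) + 1)) * (w e : ℝ) := rfl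
      _ ≤ (1 - 1 / ((k : ℝ) + 1)) := mul_le_of_le_one_right (hcmem k).1 (w e).2.2
      _ < 1 := hc
  have hc_lim : Tendsto (fun k : ℕ => (1 : ℝ) - 1 / ((k : ℝ) + 1)) atTop (𝓝 1) := by
    simpa using tendsto_const_nhds.sub (tendsto_one_div_add_atTop_nhds_zero_nat (𝕜 := ℝ))
  have hwk_lim : Tendsto wk atTop (𝓝 w) := by
    refine tendsto_pi_nhds.2 fun e => ?_
    rw [tendsto_subtype_rng]
    have h := hc_lim.mul_const (w e : ℝ)
    rw [one_mul] at h
    exact h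
  have hlimE : ∀ E : Set (Set (Sym2 (Fin n))),
      Tendsto (fun k => (prodBernoulli (wk k)).real E) atTop (𝓝 ((prodBernoulli w).real E)) :=
    fun E => ((stub_weightContinuity n E).tendsto w).comp hwk_lim
  set δ : ℕ → ℝ := fun k => ∑ a ∈ A,
      |(prodBernoulli (wk k)).real ((openConn a c : Set (BondConfig (Fin n)))ᶜ) -
        (prodBernoulli w).real ((openConn a c : Set (BondConfig (Fin n)))ᶜ)| with hδ_def
  have hδ_lim : Tendsto δ atTop (𝓝 0) := by
    have h : ∀ a ∈ A, Tendsto (fun k =>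
        |(prodBernoulli (wk k)).real ((openConn a c : Set (BondConfig (Fin n)))ᶜ) -
          (prodBernoulli w).real ((openConn a c : Set (BondConfig (Fin n)))ᶜ)|) atTop (𝓝 0) := by
      intro a _
      simpa using (tendsto_sub_nhds_zero_iff.2 (hlimE ((openConn a c : Set (BondConfig (Fin n)))ᶜ))).abs
    simpa [hδ_def] using tendsto_finsetSum A h
  have hk : ∀ k, (prodBernoulli (wk k)).real ((openConn o c : Set (BondConfig (Fin n)))ᶜ ∩ ⋃ a ∈ A, openConn o a) ≤ s + δ k := by
    intro k
    refine (hEG (wk k) (hwk_lt k)).trans (Finset.sup'_le hAne _ fun a ha => ?_)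
    have h1 := hcut a ha
    have h2 : |(prodBernoulli (wk k)).real ((openConn a c : Set (BondConfig (Fin n)))ᶜ) -
          (prodBernoulli w).real ((openConn a c : Set (BondConfig (Fin n)))ᶜ)| ≤ δ k :=
      Finset.single_le_sum (f := fun a =>
        |(prodBernoulli (wk k)).real ((openConn a c : Set (BondConfig (Fin n)))ᶜ) -
          (prodBernoulli w).real ((openConn a c : Set (BondConfig (Fin n)))ᶜ)|) (fun a _ => abs_nonneg _) ha
    have h3 := le_abs_self ((prodBernoulli (wk k)).real ((openConn a c : Set (BondConfig (Fin n)))ᶜ) -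
        (prodBernoulli w).real ((openConn a c : Set (BondConfig (Fin n)))ᶜ))
    linarith
  have hlimt : Tendsto (fun k => s + δ k) atTop (𝓝 s) := by simpa using tendsto_const_nhds.add hδ_lim
  exact le_of_tendsto_of_tendsto' (hlimE _) hlimt hk

end EventGluingClosure

end

end Summit.CriticalPhenomena.PercolationContinuityZ3.Theorems
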